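import Summits.CriticalPhenomena.CardyFormulaZ2.Theorems.CardySelfRefinementTrivialSectorRateStubBoundaryRelevanceOpenArm
import Summits.CriticalPhenomena.CardyFormulaZ2.Theorems.CardySelfRefinementTrivialSectorRateStubBoundaryRelevancePivotalWalk
import Summits.CriticalPhenomena.CardyFormulaZ2.Theorems.CardySelfRefinementTrivialSectorRateStubPivotalMassDictionary
import Literature.Probability.Percolation.QuadCrossingContinuityReduction
import HarnessLib

/-!
# Stub `real_Rel_le_pow_along` of line `far-field-is-a-quarter-turn` (crux `TrivialSectorRate`,
stmt-CriticalPhenomena-10266): THE CORNER BOUND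

The corner bound of the open stub `stub_boundaryRelevance`: along an admissible RSW path `γ`
(`PathOK k γ`, `k = 2, 3`) the `M_k(γ s)`-probability that the lattice `D`-box about the block centre
`k•u` is relevant (set-pivotal) for the localised joint crossing event of the quad family `F` at mesh
`η` decays like a power of its plane size `Dη`, uniformly in `s` and in the block `u`:
`M_k(γ s)(Rel k m F η u D) ≤ C (Dη)^c`.

Proof.  The two distinguished sides `∂₀(F i)`, `∂₂(F i)` of each of the finitely many quads are
`L`-apart for one `L > 0` (`exists_pos_forall_le_dist_side`, from the tree's
`Quad.exists_pos_le_dist_side_side_add_two`).  Take `(c', a, m₀)` from the primal one-arm decay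
`openArm_decay_along` and put `K := 32 (m₀ + 3) / L`, `c := a`, `C := (c' + 1) K^a`.  Given `s`,
`η > 0`, `D ≥ 1`, `u`, let `D₁ := max D m₀` (`Rel … u D ⊆ Rel … u D₁`, `Rel_mono`) and
`N := ⌊L/(8η) - D₁ - 2⌋₊`.
* If `D₁ + 1 ≤ N` then `8 (N + D₁ + 2) η ≤ L`, so a configuration of `Rel … u D₁` has an open walk
  from `k•u + [-D₁, D₁]²` to the outside of `k•u + [-N, N]²` (`exists_openWalk_of_mem_Rel`), an event
  of probability `≤ c' ((D₁ + 1)/N)^a` (`openArm_decay_along`); and `(D₁ + 1)/N ≤ K D η` because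
  `L < 32 η N` and `D₁ + 1 ≤ (m₀ + 3) D` (`div_le_of_floor`).
* Otherwise `L < 8 η (2 D₁ + 3) ≤ 32 (m₀ + 3) D η`, i.e. `1 ≤ K D η`, and the probability is
  `≤ 1 ≤ (K D η)^a` (`one_le_of_floor`).

Target file:
`Summits/CriticalPhenomena/CardyFormulaZ2/Theorems/CardySelfRefinementTrivialSectorRateStubBoundaryRelevanceCorner.lean`.
-/

noncomputable section

namespace Summit.CriticalPhenomena.CardyFormulaZ2.Theorems.CardySelfRefinement.FarField

open Set MeasureTheory Filter
open scoped Topology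
open Literature.Probability.LatticeModels Literature.Probability.Percolation
open Literature.Probability.Percolation.QuadCrossing
open Summit.CriticalPhenomena.CardyFormulaZ2.Theses.CardySelfRefinement

/-! ### A uniform separation of the distinguished sides of a finite quad family -/

/-- **Uniform side separation.**  For a finite family of quads there is one `L > 0` such that the
two distinguished (opposite) sides `∂₀(F i)` and `∂₂(F i)` of every quad are `L`-apart: each pair
is at positive distance (`Quad.exists_pos_le_dist_side_side_add_two`: disjoint compact sets), and a
positive real below finitely many positive reals exists (`Filter.eventually_all` in `𝓝[>] 0`;
`m = 0` is allowed). -/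
theorem exists_pos_forall_le_dist_side (m : ℕ) (F : Fin m → Quad (univ : Set ℂ)) :
    ∃ L : ℝ, 0 < L ∧ ∀ i, ∀ a ∈ (F i).side 0, ∀ b ∈ (F i).side 2, L ≤ dist a b := by
  choose ε hε hεd using fun i => (F i).exists_pos_le_dist_side_side_add_two 0
  have hev : ∀ᶠ L in 𝓝[>] (0 : ℝ), ∀ i, L ≤ ε i :=
    Filter.eventually_all.2 fun i => (eventually_le_nhds (hε i)).filter_mono nhdsWithin_le_nhds
  obtain ⟨L, hL, hL0⟩ := (hev.and self_mem_nhdsWithin).exists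
  exact ⟨L, hL0, fun i a ha b hb => (hL i).trans (hεd i a ha b (by simpa using hb))⟩

/-! ### The two arithmetic cases -/

/-- **Small boxes.**  If `N = ⌊L/(8η) - D₁ - 2⌋₊ ≥ D₁ + 1` (`D ≤ D₁ ≤ D + m₀`, `1 ≤ D`), then
`L < 32 η N` and `D₁ + 1 ≤ (m₀ + 3) D`, whence `(D₁ + 1)/N ≤ (32 (m₀ + 3)/L) · D η`. -/
theorem div_le_of_floor {L η D D₁ m₀ : ℝ} {N : ℕ} (hL : 0 < L) (hη : 0 < η) (hD : 1 ≤ D)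
    (hm₀ : 0 ≤ m₀) (hDD₁ : D ≤ D₁) (hD₁ : D₁ ≤ D + m₀) (hN : N = ⌊L / (8 * η) - D₁ - 2⌋₊)
    (hcase : D₁ + 1 ≤ N) : (D₁ + 1) / N ≤ 32 * (m₀ + 3) / L * (D * η) := by
  have hxN : L / (8 * η) - D₁ - 2 < N + 1 := hN ▸ Nat.lt_floor_add_one _
  have hN0 : (0 : ℝ) < N := by linarith
  have h8 : (0 : ℝ) < 8 * η := by positivity
  -- `L < 32 η N`
  have h1 : L / (8 * η) < 4 * N := by linarith
  have h2 : L < 32 * η * N :=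
    calc L < 4 * N * (8 * η) := (div_lt_iff₀ h8).1 h1
      _ = 32 * η * N := by ring
  -- `D₁ + 1 ≤ (m₀ + 3) D`
  have h3 : D₁ + 1 ≤ (m₀ + 3) * D := by nlinarith
  rw [div_le_iff₀ hN0]
  have h4 : 32 * (m₀ + 3) / L * (D * η) * N = (m₀ + 3) * D * (32 * η * N / L) := by
    field_simp
  rw [h4]
  have h5 : 1 ≤ 32 * η * N / L := by rw [le_div_iff₀ hL]; linarith
  have h6 : 0 ≤ (m₀ + 3) * D := by positivity
  nlinarith

/-- **Large boxes.**  If `N = ⌊L/(8η) - D₁ - 2⌋₊ ≤ D₁` (`D ≤ D₁ ≤ D + m₀`, `1 ≤ D`), then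
`L < 8 η (2 D₁ + 3) ≤ 32 (m₀ + 3) D η`, i.e. `1 ≤ (32 (m₀ + 3)/L) · D η`. -/
theorem one_le_of_floor {L η D D₁ m₀ : ℝ} {N : ℕ} (hL : 0 < L) (hη : 0 < η) (hD : 1 ≤ D)
    (hm₀ : 0 ≤ m₀) (hD₁ : D₁ ≤ D + m₀) (hN : N = ⌊L / (8 * η) - D₁ - 2⌋₊)
    (hcase : (N : ℝ) ≤ D₁) : 1 ≤ 32 * (m₀ + 3) / L * (D * η) := by
  have hxN : L / (8 * η) - D₁ - 2 < N + 1 := hN ▸ Nat.lt_floor_add_one _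
  have h8 : (0 : ℝ) < 8 * η := by positivity
  have h1 : L / (8 * η) < 2 * D₁ + 3 := by linarith
  have h2 : L < 8 * η * (2 * D₁ + 3) :=
    calc L < (2 * D₁ + 3) * (8 * η) := (div_lt_iff₀ h8).1 h1
      _ = 8 * η * (2 * D₁ + 3) := by ring
  have h3 : 2 * D₁ + 3 ≤ 4 * (m₀ + 3) * D := by nlinarith
  rw [div_mul_eq_mul_div, le_div_iff₀ hL, one_mul]
  nlinarith

/-! ### The registered stub: the corner bound -/

/-- **Corner bound** (registered stub `real_Rel_le_pow_along` of crux stmt-CriticalPhenomena-10266,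
line `far-field-is-a-quarter-turn`; input of `stub_boundaryRelevance`).  Along an admissible RSW
path `γ` (`PathOK k γ`, `k = 2, 3`) there are `c, C > 0` such that for every `s`, every mesh
`η > 0`, every radius `D ≥ 1` and EVERY block `u`, the `M_k(γ s)`-probability that the lattice
`D`-box about `k•u` is relevant (set-pivotal) for the localised joint crossing event `Aloc m F η`
is at most `C (Dη)^c`: a relevant `D`-box sends an open walk from the box to plane distance `≍ L`
(`exists_openWalk_of_mem_Rel`, `L` = the uniform separation of the distinguished sides of the
quads), which costs `≤ c' ((D + m₀)/(L/η))^a` by the primal one-arm decay `openArm_decay_along`;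
boxes of plane size `Dη ≳ L/m₀` are charged the trivial bound `1`. -/
theorem real_Rel_le_pow_along {k : ℕ} (hk : k = 2 ∨ k = 3) {γ : unitInterval → ℝ × ℝ}
    (hγ : PathOK k γ) (m : ℕ) (F : Fin m → Quad (univ : Set ℂ)) :
    ∃ c C : ℝ, 0 < c ∧ 0 < C ∧ ∀ (s : unitInterval) (η : ℝ), 0 < η → ∀ (D : ℕ), 1 ≤ D →
      ∀ u : Site 2, (M k (γ s).1 (γ s).2).real (Rel k m F η u D) ≤ C * ((D : ℝ) * η) ^ c := by
  obtain ⟨L, hL0, hL⟩ := exists_pos_forall_le_dist_side m F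
  obtain ⟨c', a, hc', ha, m₀, harm⟩ := openArm_decay_along hk hγ
  set K : ℝ := 32 * ((m₀ : ℝ) + 3) / L with hK
  have hK0 : 0 < K := by positivity
  refine ⟨a, (c' + 1) * K ^ a, ha, by positivity, fun s η hη D hD u => ?_⟩
  haveI := isProbabilityMeasure_M k (γ s).1 (γ s).2
  have hDr : (1 : ℝ) ≤ D := by exact_mod_cast hD
  have hDη : (0 : ℝ) ≤ (D : ℝ) * η := by positivity
  have hKDη : (0 : ℝ) ≤ K * ((D : ℝ) * η) := by positivity
  have hsplit : (c' + 1) * K ^ a * ((D : ℝ) * η) ^ a = (c' + 1) * (K * ((D : ℝ) * η)) ^ a := by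
    rw [Real.mul_rpow hK0.le hDη]; ring
  rw [hsplit]
  have hpow0 : 0 ≤ (K * ((D : ℝ) * η)) ^ a := Real.rpow_nonneg hKDη a
  -- enlarge the box to radius `D₁ ≥ m₀`
  set D₁ : ℕ := max D m₀ with hD₁
  have hDD₁ : D ≤ D₁ := le_max_left _ _
  have hmD₁ : m₀ ≤ D₁ := le_max_right _ _
  have hD₁le : D₁ ≤ D + m₀ := max_le (Nat.le_add_right _ _) (Nat.le_add_left _ _)
  have hDD₁r : (D : ℝ) ≤ D₁ := by exact_mod_cast hDD₁
  have hD₁r : (D₁ : ℝ) ≤ D + m₀ := by exact_mod_cast hD₁le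
  -- the target radius
  set N : ℕ := ⌊L / (8 * η) - D₁ - 2⌋₊ with hN
  by_cases hcase : D₁ + 1 ≤ N
  · -- small boxes: an open arm from `k•u + B(D₁)` to the outside of `k•u + B(N)`
    have hN0 : 0 < N := by omega
    have hx1 : (1 : ℝ) ≤ L / (8 * η) - D₁ - 2 := Nat.floor_pos.1 hN0
    have hNx : (N : ℝ) ≤ L / (8 * η) - D₁ - 2 := Nat.floor_le (by linarith)
    have hcond : 8 * ((N : ℝ) + D₁ + 2) * η ≤ L := by
      have h8 : (0 : ℝ) < 8 * η := by positivity
      have : (N : ℝ) + D₁ + 2 ≤ L / (8 * η) := by linarith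
      rw [le_div_iff₀ h8] at this
      linarith
    have hsub : Rel k m F η u D ⊆ {ω | ∃ (v w : Site 2) (q : (zdGraph 2).Walk v w),
        v - ctr k u ∈ box 2 (D₁ + 1 - 1) ∧ w - ctr k u ∉ box 2 N ∧ ∀ e ∈ q.edges, e ∈ ω} := by
      intro ω hω
      obtain ⟨v, w, p, hv, hw, hp⟩ :=
        exists_openWalk_of_mem_Rel k m F hη hL u hcond (Rel_mono k m F η u hDD₁ hω)
      exact ⟨v, w, p, by rwa [Nat.add_sub_cancel], hw, hp⟩
    have hcaseR : ((D₁ : ℝ) + 1) ≤ N := by exact_mod_cast hcase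
    have hratio : (((D₁ + 1 : ℕ) : ℝ) / N) ≤ K * ((D : ℝ) * η) := by
      push_cast
      exact div_le_of_floor hL0 hη hDr (Nat.cast_nonneg m₀) hDD₁r hD₁r hN hcaseR
    calc (M k (γ s).1 (γ s).2).real (Rel k m F η u D)
        ≤ (M k (γ s).1 (γ s).2).real {ω | ∃ (v w : Site 2) (q : (zdGraph 2).Walk v w),
            v - ctr k u ∈ box 2 (D₁ + 1 - 1) ∧ w - ctr k u ∉ box 2 N ∧ ∀ e ∈ q.edges, e ∈ ω} :=
          measureReal_mono hsub
      _ ≤ c' * (((D₁ + 1 : ℕ) : ℝ) / N) ^ a := harm s (ctr k u) (D₁ + 1) N (by omega) hcase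
      _ ≤ c' * (K * ((D : ℝ) * η)) ^ a :=
          mul_le_mul_of_nonneg_left (Real.rpow_le_rpow (by positivity) hratio ha.le) hc'.le
      _ ≤ (c' + 1) * (K * ((D : ℝ) * η)) ^ a := by nlinarith
  · -- large boxes: the trivial bound
    push Not at hcase
    have hcaseR : (N : ℝ) ≤ D₁ := by exact_mod_cast Nat.lt_succ_iff.1 hcase
    have h1 : 1 ≤ K * ((D : ℝ) * η) :=
      one_le_of_floor hL0 hη hDr (Nat.cast_nonneg m₀) hD₁r hN hcaseR
    calc (M k (γ s).1 (γ s).2).real (Rel k m F η u D) ≤ 1 := measureReal_le_one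
      _ ≤ (K * ((D : ℝ) * η)) ^ a := Real.one_le_rpow h1 ha.le
      _ ≤ (c' + 1) * (K * ((D : ℝ) * η)) ^ a := by nlinarith

end Summit.CriticalPhenomena.CardyFormulaZ2.Theorems.CardySelfRefinement.FarField

end
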